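import Mathlib
import HarnessLib
import Literature.Analysis.Fourier.TorusGridRiemannSum
import Literature.MathematicalPhysics.QuantumLattice.HubbardUVSymbolFibreSampling
import Literature.MathematicalPhysics.QuantumLattice.KohnLuttinger

/-!
# Route `KLProgramme` — crux C4a, LAYER 2 of the tadpole representation, first brick: the loop SUM over the Brillouin-zone grid
# `(2π/L)ℤ_L²` of a smooth `2π`-periodic integrand is `L²·(2π)⁻²·∫_{(−π,π)²}` up to ALIASED Fourier coefficients

Cell `gate-hubbard-kl`, lane hubbard-kl-c4a-1 (g3); helper for stub (C) `stub_twoLeg_curvature` of the engine-flow child `KLRegimeEngineV17F2`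
(stmt-HubbardSuperconductivity-20437); memo HOME/hubbard-kl-c4a-1/C4A-PLAN.md §15.5 (finding F3): LAYER 1 (r2d-p1, `…KLRegimeSplitTwoLegIncrementRep`)
writes the scale-`n` two-leg increment at a fixed frame as the LATTICE loop sum `Σ_{q⃗ ∈ (2π/L)ℤ_L²} ŝ(e_K(q⃗))·V(k, q⃗)`, whereas the co-moving change of
variables of the tube tadpole-jet theorem (…C4aTubeTadpole) needs a CONTINUUM loop integral over the zone `(−π,π)²` (as an `ℝ × ℝ` box, momenta read
through `WithLp.toLp 2 ![q.1, q.2]`).  The bridge is Poisson summation on the grid (Literature `…Fourier.TorusGridPoissonSummation` /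
`…Fourier.TorusGridRiemannSum`, unit torus `(ℝ/ℤ)²`) after the rescaling `q = 2π·y`:

* §1 `toLp_latticeMomentum_eq_smul` (`p_k⃗ = 2π·(k⃗/L)`), `isLatticePeriodic_rescale` (a `2π`-periodic `Φ` on the momentum plane rescales to a
  `ℤ²`-periodic function), `periodic_single_of_planePeriodic` (the lineage's `PlanePeriodic` hypothesis in coordinate form);
* §2 `smul_vadd_unitCube_eq_zone` (`2π·((−½,−½) + [0,1)²) = [−π,π)²`), `setIntegral_zone_eq_box` (the zone integral on `EuclideanSpace ℝ (Fin 2)` is the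
  `ℝ × ℝ` box integral, volume-preserving coordinates), **`setIntegral_unitCube_rescale`**: `∫_{[0,1)²} Φ(2πy) dy = (2π)⁻²·∫_{[−π,π)²} Φ` (periodicity moves
  the cell to the centred one);
* §3 **`sum_latticeMomentum_eq`** — `Σ_{k⃗ ∈ ℤ_L²} Φ(p_k⃗) = L²·Σ_{m : L ∣ m} 𝓕(Φ♭)(m)` (`Φ♭` = the descent of `y ↦ Φ(2πy)` to `(ℝ/ℤ)²`) and
  **`norm_latticeMomentumAvg_sub_zoneIntegral_le`** — `‖L⁻²Σ_{k⃗} Φ(p_k⃗) − (2π)⁻²∫_{[−π,π)²} Φ‖ ≤ Σ_{m ≠ 0, L ∣ m} ‖𝓕(Φ♭)(m)‖` for smooth periodic `Φ`.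

The ALIASED TAIL on the right is estimated structurally in LAYER 2 proper (for `Φ = (ŝ∘e_K)·V` with `V` a trigonometric polynomial of degree `< L/2`:
Literature `…Fourier.TorusGridAliasingTail.tsum_aliased_norm_mFourierCoeff_trigPoly_mul_le`).  Pure bookkeeping; nothing is asserted about the Hubbard model.
References: BGM 2006 §2.1 (2.3) (the finite-volume momenta) [cite: BenfattoGiulianiMastropietro2006]; Boyd 2001 §4.5 Thm 19–20 (aliasing) [cite: Boyd2001].
-/

noncomputable section

namespace Summit.HubbardSuperconductivity.HubbardSuperconductivity.Theorems.C4a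

set_option linter.dupNamespace false -- summit = problem name (single-conjunct summit), D-0017

open Real Set MeasureTheory UnitAddTorus
open scoped Pointwise
open Literature.Probability.LatticeModels Literature.MathematicalPhysics.QuantumLattice
open Literature.Analysis.Fourier Literature.Analysis.FunctionSpaces

/-! ## §1 Rescaling the grid and the periodicity -/

/-- **`p_k⃗ = 2π·(k⃗/L)`**: the lattice momentum is the rescaled unit-torus grid point. -/
theorem toLp_latticeMomentum_eq_smul (L : ℕ) (k : TorusSite 2 L) :
    (WithLp.toLp 2 (latticeMomentum L k) : Momentum) = (2 * π) • (WithLp.toLp 2 fun i => ((k i).val : ℝ) / L : Momentum) := by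
  ext i
  simp only [latticeMomentum, PiLp.smul_apply, smul_eq_mul]
  ring

/-- A `2π`-periodic function on the momentum plane (coordinate form) rescales to a `ℤ²`-periodic function `y ↦ Φ(2πy)`. -/
theorem isLatticePeriodic_rescale {E : Type*} {Φ : Momentum → E} (hper : ∀ (j : Fin 2) (q : Momentum), Φ (q + EuclideanSpace.single j (2 * π)) = Φ q) :
    Torus.IsLatticePeriodic (fun y : Momentum => Φ ((2 * π) • y)) := by
  intro j y
  have h : (2 * π) • (y + EuclideanSpace.single j (1 : ℝ)) = (2 * π) • y + EuclideanSpace.single j (2 * π) := by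
    rw [smul_add]
    congr 1
    ext i
    by_cases hij : i = j
    · subst hij; simp
    · simp [hij]
  simp only [h, hper]

/-- The lineage's `PlanePeriodic` hypothesis (on `p ↦ Φ (toLp p)`) gives the coordinate form `Φ (q + 2π e_j) = Φ q`. -/
theorem periodic_single_of_planePeriodic {E : Type*} {Φ : Momentum → E} (h : PlanePeriodic fun p : Fin 2 → ℝ => Φ (WithLp.toLp 2 p))
    (j : Fin 2) (q : Momentum) : Φ (q + EuclideanSpace.single j (2 * π)) = Φ q := by
  have h1 := h (WithLp.ofLp q) (Pi.single j 1)
  have h2 : (WithLp.toLp 2 fun i => WithLp.ofLp q i + ((Pi.single j (1 : ℤ) : Fin 2 → ℤ) i : ℝ) * (2 * π) : Momentum) =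
      q + EuclideanSpace.single j (2 * π) := by
    ext i
    by_cases hij : i = j
    · subst hij; simp
    · simp [hij]
  simp only at h1
  rw [h2, WithLp.toLp_ofLp] at h1
  exact h1

/-! ## §2 The centred zone and the `ℝ × ℝ` box -/

/-- **`2π·((−½,−½) + [0,1)²) = [−π,π)²`** in the momentum plane. -/
theorem smul_vadd_unitCube_eq_zone :
    (2 * π) • ((WithLp.toLp 2 (fun _ : Fin 2 => -(1 / 2 : ℝ)) : Momentum) +ᵥ Torus.unitCube (Fin 2)) =
      {q : Momentum | ∀ i, q i ∈ Ico (-π) π} := by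
  have h2π : (0 : ℝ) < 2 * π := by positivity
  ext q
  rw [Set.mem_smul_set_iff_inv_smul_mem₀ h2π.ne', Set.mem_vadd_set_iff_neg_vadd_mem, vadd_eq_add, Torus.mem_unitCube, Set.mem_setOf_eq]
  refine forall_congr' fun i => ?_
  simp only [PiLp.add_apply, PiLp.neg_apply, PiLp.smul_apply, smul_eq_mul, Set.mem_Ico]
  have e : -(-(1 / 2 : ℝ)) + (2 * π)⁻¹ * q i = (q i + π) / (2 * π) := by
    rw [add_div, div_eq_inv_mul, show π / (2 * π) = 1 / 2 by rw [div_eq_iff h2π.ne']; ring]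
    ring
  rw [e, le_div_iff₀ h2π, div_lt_iff₀ h2π]
  constructor
  · rintro ⟨h1, h2⟩; constructor <;> linarith
  · rintro ⟨h1, h2⟩; constructor <;> linarith

/-- **The zone integral on the momentum plane is the `ℝ × ℝ` box integral** (volume-preserving coordinates `p ↦ toLp ![p.1, p.2]`). -/
theorem setIntegral_zone_eq_box {E : Type*} [NormedAddCommGroup E] [NormedSpace ℝ E] (Φ : Momentum → E) (a b : ℝ) :
    ∫ q in {q : Momentum | ∀ i, q i ∈ Ico a b}, Φ q = ∫ p in Ico a b ×ˢ Ico a b, Φ (WithLp.toLp 2 ![p.1, p.2]) := by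
  -- the volume-preserving coordinates `ℝ × ℝ → EuclideanSpace ℝ (Fin 2)`, `p ↦ toLp ![p.1, p.2]`
  have hmp : MeasurePreserving (fun p : ℝ × ℝ => (WithLp.toLp 2 ![p.1, p.2] : Momentum)) volume volume :=
    (PiLp.volume_preserving_toLp (Fin 2)).comp (volume_preserving_finTwoArrow ℝ).symm
  have hemb : MeasurableEmbedding (fun p : ℝ × ℝ => (WithLp.toLp 2 ![p.1, p.2] : Momentum)) :=
    (MeasurableEquiv.toLp 2 (Fin 2 → ℝ)).measurableEmbedding.comp (MeasurableEquiv.finTwoArrow (α := ℝ)).symm.measurableEmbedding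
  have hpre : (fun p : ℝ × ℝ => (WithLp.toLp 2 ![p.1, p.2] : Momentum)) ⁻¹' {q : Momentum | ∀ i, q i ∈ Ico a b} = Ico a b ×ˢ Ico a b := by
    ext p
    simp only [Set.mem_preimage, Set.mem_setOf_eq, Fin.forall_fin_two, Set.mem_prod]
    exact Iff.rfl
  rw [← hpre, hmp.setIntegral_preimage_emb hemb]

/-- **`∫_{[0,1)²} Φ(2πy) dy = (2π)⁻²·∫_{[−π,π)²} Φ`** for a `2π`-periodic `Φ` (the period cell is moved to the centred one by periodicity, then
rescaled; the right-hand side as an `ℝ × ℝ` box integral). -/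
theorem setIntegral_unitCube_rescale {E : Type*} [NormedAddCommGroup E] [NormedSpace ℝ E] {Φ : Momentum → E}
    (hper : ∀ (j : Fin 2) (q : Momentum), Φ (q + EuclideanSpace.single j (2 * π)) = Φ q) :
    ∫ y in Torus.unitCube (Fin 2), Φ ((2 * π) • y) = ((2 * π) ^ 2)⁻¹ • ∫ p in Ico (-π) π ×ˢ Ico (-π) π, Φ (WithLp.toLp 2 ![p.1, p.2]) := by
  have h2π : (0 : ℝ) < 2 * π := by positivity
  rw [← setIntegral_vadd_unitCube_eq_of_isLatticePeriodic _ (isLatticePeriodic_rescale hper) (WithLp.toLp 2 (fun _ : Fin 2 => -(1 / 2 : ℝ))),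
    Measure.setIntegral_comp_smul_of_pos volume Φ _ h2π, smul_vadd_unitCube_eq_zone, finrank_euclideanSpace_fin, setIntegral_zone_eq_box]

/-! ## §3 The bridge -/

section Bridge

variable {L : ℕ} [NeZero L] {Φ : Momentum → ℂ} (hΦ : ContDiff ℝ (⊤ : ℕ∞) Φ)
  (hper : ∀ (j : Fin 2) (q : Momentum), Φ (q + EuclideanSpace.single j (2 * π)) = Φ q)
include hΦ hper

/-- **The loop sum over the Brillouin-zone grid, exactly**: `Σ_{k⃗ ∈ ℤ_L²} Φ(p_k⃗) = L²·Σ_{m : L ∣ m} 𝓕(Φ♭)(m)`, `Φ♭` the descent of `y ↦ Φ(2πy)` to the unit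
torus. [cite: Boyd2001, §4.5 Theorem 19 (4.44)] -/
theorem sum_latticeMomentum_eq :
    ∑ k : TorusSite 2 L, Φ (WithLp.toLp 2 (latticeMomentum L k)) =
      (L : ℂ) ^ 2 * ∑' m : Fin 2 → ℤ, (if ∀ i, (L : ℤ) ∣ m i then
        mFourierCoeff (Torus.descend (fun y : Momentum => Φ ((2 * π) • y)) (isLatticePeriodic_rescale hper)) m else 0) := by
  have hs : ContDiff ℝ (⊤ : ℕ∞) (fun y : Momentum => Φ ((2 * π) • y)) := hΦ.comp (contDiff_const_smul _)
  have h := sum_grid_eq_mul_tsum_mFourierCoeff_of_contDiff L _ (isLatticePeriodic_rescale hper) hs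
  simp only [Fintype.card_fin] at h
  simp only [toLp_latticeMomentum_eq_smul]
  convert h using 7

/-- **THE BRIDGE (finding F3)**: `‖L⁻²·Σ_{k⃗ ∈ ℤ_L²} Φ(p_k⃗) − (2π)⁻²·∫_{[−π,π)²} Φ‖ ≤ Σ_{m ≠ 0, L ∣ m} ‖𝓕(Φ♭)(m)‖` for a smooth `2π`-periodic `Φ` on
the momentum plane — the grid average of the loop integrand is the zone average up to the aliased Fourier coefficients.
[cite: Boyd2001, §4.5 Theorem 20 (4.47)] -/
theorem norm_latticeMomentumAvg_sub_zoneIntegral_le :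
    ‖((L : ℂ) ^ 2)⁻¹ * ∑ k : TorusSite 2 L, Φ (WithLp.toLp 2 (latticeMomentum L k)) -
        ((2 * π) ^ 2)⁻¹ • ∫ p in Ico (-π) π ×ˢ Ico (-π) π, Φ (WithLp.toLp 2 ![p.1, p.2])‖ ≤
      ∑' m : Fin 2 → ℤ, (if m ≠ 0 ∧ ∀ i, (L : ℤ) ∣ m i then
        ‖mFourierCoeff (Torus.descend (fun y : Momentum => Φ ((2 * π) • y)) (isLatticePeriodic_rescale hper)) m‖ else 0) := by
  have hs : ContDiff ℝ (⊤ : ℕ∞) (fun y : Momentum => Φ ((2 * π) • y)) := hΦ.comp (contDiff_const_smul _)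
  have h := norm_gridAvg_sub_setIntegral_unitCube_le_of_contDiff L _ (isLatticePeriodic_rescale hper) hs
  simp only [Fintype.card_fin] at h
  rw [setIntegral_unitCube_rescale hper] at h
  simp only [toLp_latticeMomentum_eq_smul]
  convert h using 7

end Bridge

end Summit.HubbardSuperconductivity.HubbardSuperconductivity.Theorems.C4a

end
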